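import Summits.AtomisticToContinuum.Crystallization.Theorems.FreeSplittingCertificatesRadiusLadderScaling

/-!
# Radius ladder for `FiniteRangeSplitting`: COMPACTNESS OF THE RULE SPACE — every radius has an
# ATTAINED sharp hard-core threshold `δ*(R)`, and crux r2 is `δ*(R) → 0`

Route `FreeSplittingCertificates`, cruxes r2 `FiniteRangeSplitting` (stmt-AtomisticToContinuum-12559) and r5
`ApproxFiniteRangeSplitting` (stmt-12562); block-2b unit `b2b-freesplit`, PART A gen 14.  Value = structural
theorems about the cruxes — NOT summit progress.

The pair-splitting rules `Φ : E3 → Finset E3 → ℝ` with values in `[0, 1]` form a COMPACT set for the product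
topology (Tychonoff, `isCompact_univ_pi`), the rule axioms and `ε`-feasibility at `(δ, R)` are CLOSED conditions
(each constraint involves finitely many evaluations `Φ v T`, which are continuous), so

* `arungAt_of_forall_gt_eps` (**closedness in the tolerance at fixed radius**): if `ARungAt δ (ε + η) R` for every
  `η > 0` then `ARungAt δ ε R` (nested nonempty compacts); hence `rungAt_iff_forall_arungAt :
  RungAt δ R ↔ ∀ ε > 0, ARungAt δ ε R` — cruxes r2 and r5 differ ONLY in whether the radius may blow up as
  `ε → 0` (`finiteRangeSplitting_of_bounded_radius`);
* with the dilation of `…RadiusLadderScaling` (**closedness in the hard core at fixed radius**):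
  `rungAt_of_forall_gt_sep : 0 < δ → 0 ≤ R → (∀ δ' > δ, RungAt δ' R) → RungAt δ R`;
* so for every radius `R ≥ 0` the rung `S_R(δ)` holds exactly on a CLOSED RAY: `δ*(R) := sepThreshold R =
  inf {δ > 0 | RungAt δ R}` is attained when positive and `RungAt δ R ↔ δ*(R) ≤ δ` for `δ > 0`
  (`rungAt_iff_sepThreshold_le`); `δ*` is antitone, `δ*(R) = δ_½` for `R < 47/50`
  (`sepThreshold_eq_halfSumThreshold_of_lt`, by `not_rungAt_47_50`), `δ_c ≤ δ*(R) ≤ δ_½`, `δ_c = inf_R δ*(R)`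
  (`isGLB_critSep`, `critSep_eq_iInf`), `δ*(R) → δ_c` (`tendsto_sepThreshold`), and
  **`FiniteRangeSplitting ↔ δ*(R) → 0 as R → ∞`** (`finiteRangeSplitting_iff_tendsto`);
* `critSep_mem_rungSet_of_bounded`: if the rungs just above a positive `δ_c` can be read at one bounded radius,
  `δ_c` is attained — non-attainment of `δ_c` forces the rung radius to blow up.

The task cell's object `S_2(4/5)` is the inequality `δ*(2) ≤ 4/5`; certified: `δ*(2) ∈ [δ_c, δ_½] ⊆ [0, 6/5]`.
-/

noncomputable section

namespace Summit.AtomisticToContinuum.Crystallization.Theorems.StrictSplittingRuleBirth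

open scoped BigOperators Classical Topology
open Filter Literature.MathematicalPhysics.StatisticalMechanics

/-- Euclidean `3`-space. -/
local notation "E3" => EuclideanSpace ℝ (Fin 3)

/-! ## 1. The rule space is compact; rule axioms and feasibility are closed -/

/-- Evaluation `Φ ↦ Φ v T` is continuous for the product topology on rules. [folklore] -/
theorem continuous_eval_rule (v : E3) (T : Finset E3) :
    Continuous fun Φ : E3 → Finset E3 → ℝ => Φ v T := by
  show Continuous ((fun g : Finset E3 → ℝ => g T) ∘ (fun Φ : E3 → Finset E3 → ℝ => Φ v))
  exact (continuous_apply T).comp (continuous_apply v)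

/-- The weighted site energy is continuous in the rule (a finite sum of evaluations times constants). -/
theorem continuous_siteE (R : ℝ) {N : ℕ} (x : Fin N → E3) (i : Fin N) :
    Continuous fun Φ : E3 → Finset E3 → ℝ => siteE R Φ x i := by
  unfold siteE
  exact continuous_finsetSum _ fun j _ => (continuous_eval_rule _ _).mul continuous_const

/-- The box `0 ≤ Φ ≤ 1` is compact (Tychonoff). [folklore] -/
theorem isCompact_ruleBox :
    IsCompact {Φ : E3 → Finset E3 → ℝ | ∀ v T, 0 ≤ Φ v T ∧ Φ v T ≤ 1} := by
  have h : {Φ : E3 → Finset E3 → ℝ | ∀ v T, 0 ≤ Φ v T ∧ Φ v T ≤ 1} =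
      Set.pi Set.univ (fun _ : E3 => Set.pi Set.univ (fun _ : Finset E3 => Set.Icc (0 : ℝ) 1)) := by
    ext Φ
    simp only [Set.mem_setOf_eq, Set.mem_univ_pi, Set.mem_Icc]
  rw [h]
  exact isCompact_univ_pi fun _ => isCompact_univ_pi fun _ => isCompact_Icc

/-- The rule axioms are a closed condition. -/
theorem isClosed_setOf_isRule : IsClosed {Φ : E3 → Finset E3 → ℝ | IsRule Φ} := by
  have hbox : IsClosed {Φ : E3 → Finset E3 → ℝ | ∀ v T, 0 ≤ Φ v T ∧ Φ v T ≤ 1} := by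
    have h : {Φ : E3 → Finset E3 → ℝ | ∀ v T, 0 ≤ Φ v T ∧ Φ v T ≤ 1} =
        ⋂ v : E3, ⋂ T : Finset E3, ({Φ | 0 ≤ Φ v T} ∩ {Φ | Φ v T ≤ 1}) := by
      ext Φ
      simp only [Set.mem_setOf_eq, Set.mem_iInter, Set.mem_inter_iff]
    rw [h]
    exact isClosed_iInter fun v => isClosed_iInter fun T =>
      (isClosed_le continuous_const (continuous_eval_rule v T)).inter
        (isClosed_le (continuous_eval_rule v T) continuous_const)
  have hcomp : IsClosed {Φ : E3 → Finset E3 → ℝ |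
      ∀ v T, v ≠ 0 → Φ v T + Φ (-v) (T.image fun u => u - v) = 1} := by
    have h : {Φ : E3 → Finset E3 → ℝ | ∀ v T, v ≠ 0 → Φ v T + Φ (-v) (T.image fun u => u - v) = 1} =
        ⋂ v : E3, ⋂ T : Finset E3, ⋂ (_ : v ≠ 0), {Φ | Φ v T + Φ (-v) (T.image fun u => u - v) = 1} := by
      ext Φ
      simp only [Set.mem_setOf_eq, Set.mem_iInter]
    rw [h]
    exact isClosed_iInter fun v => isClosed_iInter fun T => isClosed_iInter fun _ =>
      isClosed_eq ((continuous_eval_rule v T).add (continuous_eval_rule _ _)) continuous_const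
  have h : {Φ : E3 → Finset E3 → ℝ | IsRule Φ} = {Φ | ∀ v T, 0 ≤ Φ v T ∧ Φ v T ≤ 1} ∩
      {Φ | ∀ v T, v ≠ 0 → Φ v T + Φ (-v) (T.image fun u => u - v) = 1} := by
    ext Φ
    simp only [IsRule, Set.mem_setOf_eq, Set.mem_inter_iff]
  rw [h]
  exact hbox.inter hcomp

/-- `ε`-feasibility at `(δ, R)` is a closed condition. -/
theorem isClosed_setOf_afeasible (δ ε R : ℝ) :
    IsClosed {Φ : E3 → Finset E3 → ℝ | AFeasible δ ε R Φ} := by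
  have h : {Φ : E3 → Finset E3 → ℝ | AFeasible δ ε R Φ} =
      ⋂ N : ℕ, ⋂ x : Fin N → E3, ⋂ (_ : Sep δ x), ⋂ i : Fin N, {Φ | eInf - ε ≤ siteE R Φ x i} := by
    ext Φ
    simp only [AFeasible, Set.mem_setOf_eq, Set.mem_iInter]
  rw [h]
  exact isClosed_iInter fun N => isClosed_iInter fun x => isClosed_iInter fun _ =>
    isClosed_iInter fun i => isClosed_le continuous_const (continuous_siteE R x i)

/-- The set of `ε`-feasible rules at `(δ, R)` is compact. -/
theorem isCompact_setOf_arung (δ ε R : ℝ) :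
    IsCompact ({Φ : E3 → Finset E3 → ℝ | IsRule Φ} ∩ {Φ | AFeasible δ ε R Φ}) :=
  isCompact_ruleBox.of_isClosed_subset (isClosed_setOf_isRule.inter (isClosed_setOf_afeasible δ ε R))
    fun _ h => h.1.1

/-! ## 2. Closedness in the tolerance at fixed radius -/

/-- **Closedness in `ε` at fixed radius.**  If `ARungAt δ (ε + η) R` for every `η > 0`, then `ARungAt δ ε R`:
the sets of `(ε + 1/(n+1))`-feasible rules are nested nonempty compacts. -/
theorem arungAt_of_forall_gt_eps {δ ε R : ℝ} (h : ∀ η : ℝ, 0 < η → ARungAt δ (ε + η) R) :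
    ARungAt δ ε R := by
  let t : ℕ → Set (E3 → Finset E3 → ℝ) := fun n =>
    {Φ | IsRule Φ} ∩ {Φ | AFeasible δ (ε + 1 / ((n : ℝ) + 1)) R Φ}
  have htd : ∀ n, t (n + 1) ⊆ t n := by
    intro n Φ hΦ
    have h1 : AFeasible δ (ε + 1 / (((n + 1 : ℕ) : ℝ) + 1)) R Φ := hΦ.2
    refine ⟨hΦ.1, fun N x hx i => ?_⟩
    have h2 := h1 N x hx i
    have hle : 1 / ((n : ℝ) + 1 + 1) ≤ 1 / ((n : ℝ) + 1) :=
      one_div_le_one_div_of_le (by positivity) (by linarith)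
    push_cast at h2
    linarith
  have htn : ∀ n, (t n).Nonempty := fun n => by
    obtain ⟨Φ, hr, hf⟩ := h (1 / ((n : ℝ) + 1)) (by positivity)
    exact ⟨Φ, hr, hf⟩
  have htcl : ∀ n, IsClosed (t n) := fun n =>
    isClosed_setOf_isRule.inter (isClosed_setOf_afeasible _ _ _)
  have ht0 : IsCompact (t 0) := isCompact_setOf_arung _ _ _
  obtain ⟨Φ, hΦ⟩ := IsCompact.nonempty_iInter_of_sequence_nonempty_isCompact_isClosed t htd htn ht0 htcl
  have hmem : ∀ n, Φ ∈ t n := Set.mem_iInter.1 hΦ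
  have hrule : IsRule Φ := (hmem 0).1
  refine ⟨Φ, hrule, fun N x hx i => ?_⟩
  by_contra hlt
  have hlt' : siteE R Φ x i < eInf - ε := not_le.mp hlt
  obtain ⟨n, hn⟩ := exists_nat_one_div_lt (show 0 < eInf - ε - siteE R Φ x i by linarith)
  have h1 : AFeasible δ (ε + 1 / ((n : ℝ) + 1)) R Φ := (hmem n).2
  have h2 := h1 N x hx i
  linarith

/-- **Exact rung = `ε`-rungs for all `ε` at the SAME radius**: `RungAt δ R ↔ ∀ ε > 0, ARungAt δ ε R`. -/
theorem rungAt_iff_forall_arungAt {δ R : ℝ} : RungAt δ R ↔ ∀ ε : ℝ, 0 < ε → ARungAt δ ε R := by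
  refine ⟨fun h ε hε => arungAt_of_rungAt hε.le h, fun h => ?_⟩
  rw [← arungAt_zero_iff]
  exact arungAt_of_forall_gt_eps fun η hη => by rw [zero_add]; exact h η hη

/-- Cruxes r2 and r5 differ only by a possible radius blow-up as `ε → 0`: r5 with radii bounded uniformly in `ε`
(at each hard core) implies r2. -/
theorem finiteRangeSplitting_of_bounded_radius
    (h : ∀ δ : ℝ, 0 < δ → ∃ R : ℝ, 0 < R ∧ ∀ ε : ℝ, 0 < ε → ARungAt δ ε R) :
    Summit.AtomisticToContinuum.Crystallization.Theses.FreeSplittingCertificates.FiniteRangeSplitting := by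
  rw [finiteRangeSplitting_iff_rung]
  intro δ hδ
  obtain ⟨R, hR, hall⟩ := h δ hδ
  exact ⟨R, hR, rungAt_iff_forall_arungAt.2 hall⟩

/-! ## 3. Closedness in the hard core at fixed radius (dilation + compactness) -/

/-- The price of the dilation `c = 1 + η δ⁶ / 250` is exactly `η`. -/
theorem dilation_price {δ η : ℝ} (hδ : δ ≠ 0) : 250 * (η * δ ^ 6 / 250) * δ⁻¹ ^ 6 = η := by
  rw [inv_pow]
  field_simp

/-- **Closedness in `δ` at fixed radius `R ≥ 0`, `ε`-version**: if every hard core above `δ > 0` carries an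
`ε`-rung of radius `R`, so does `δ`. -/
theorem arungAt_of_forall_gt_sep {δ ε R : ℝ} (hδ : 0 < δ) (hR : 0 ≤ R)
    (h : ∀ δ' : ℝ, δ < δ' → ARungAt δ' ε R) : ARungAt δ ε R := by
  refine arungAt_of_forall_gt_eps fun η hη => ?_
  set c : ℝ := 1 + η * δ ^ 6 / 250 with hc_def
  have hpos : 0 < η * δ ^ 6 / 250 := by positivity
  have hc1 : 1 < c := by rw [hc_def]; linarith
  have key := arungAt_of_arungAt_mul hδ hc1.le (h (c * δ) (lt_mul_of_one_lt_left hδ hc1))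
  have hc' : c - 1 = η * δ ^ 6 / 250 := by rw [hc_def]; ring
  rw [hc', dilation_price hδ.ne'] at key
  exact arungAt_mono_radius (div_le_self hR hc1.le) key

/-- **Closedness in `δ` at fixed radius `R ≥ 0`**: if every hard core above `δ > 0` carries a rung of radius `R`,
so does `δ`. -/
theorem rungAt_of_forall_gt_sep {δ R : ℝ} (hδ : 0 < δ) (hR : 0 ≤ R)
    (h : ∀ δ' : ℝ, δ < δ' → RungAt δ' R) : RungAt δ R := by
  rw [← arungAt_zero_iff]
  exact arungAt_of_forall_gt_sep hδ hR fun δ' hδ' => (arungAt_zero_iff δ' R).2 (h δ' hδ')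

/-- If the rungs just above a positive critical hard core `δ_c` can all be read at ONE radius `R₀`, then `δ_c`
is attained; equivalently, non-attainment of `δ_c` forces the rung radius to blow up as `δ ↓ δ_c`. -/
theorem critSep_mem_rungSet_of_bounded (hpos : 0 < critSep) {R₀ : ℝ} (hR : 0 < R₀)
    (h : ∀ δ : ℝ, critSep < δ → RungAt δ R₀) : critSep ∈ RungSet :=
  ⟨hpos, R₀, hR, rungAt_of_forall_gt_sep hpos hR.le h⟩

/-! ## 4. The sharp hard-core threshold `δ*(R)` of the radius-`R` rung -/

/-- The positive hard cores at which the radius-`R` rung holds. [folklore] -/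
def RungSetAt (R : ℝ) : Set ℝ := {δ : ℝ | 0 < δ ∧ RungAt δ R}

/-- `RungSetAt R` is an up-set. -/
theorem mem_rungSetAt_of_le {R δ δ' : ℝ} (h : δ ∈ RungSetAt R) (hle : δ ≤ δ') : δ' ∈ RungSetAt R :=
  ⟨h.1.trans_le hle, rungAt_mono_sep hle h.2⟩

/-- `RungSetAt` grows with the radius. -/
theorem rungSetAt_mono {R R' : ℝ} (h : R ≤ R') : RungSetAt R ⊆ RungSetAt R' :=
  fun _ hδ => ⟨hδ.1, rungAt_mono_radius h hδ.2⟩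

/-- `δ_½ ∈ RungSetAt R` for every `R` (the half rule). -/
theorem halfSumThreshold_mem_rungSetAt (R : ℝ) : halfSumThreshold ∈ RungSetAt R :=
  ⟨halfSumThreshold_pos, rungAt_halfSumThreshold R⟩

/-- `RungSetAt R` is nonempty. -/
theorem rungSetAt_nonempty (R : ℝ) : (RungSetAt R).Nonempty :=
  ⟨_, halfSumThreshold_mem_rungSetAt R⟩

/-- `RungSetAt R` is bounded below by `0`. -/
theorem rungSetAt_bddBelow (R : ℝ) : BddBelow (RungSetAt R) :=
  ⟨0, fun _ h => h.1.le⟩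

/-- `RungSetAt R ⊆ RungSet`. -/
theorem rungSetAt_subset_rungSet (R : ℝ) : RungSetAt R ⊆ RungSet :=
  fun _ h => ⟨h.1, max R 1, lt_max_of_lt_right one_pos, rungAt_mono_radius (le_max_left R 1) h.2⟩

/-- **`RungSetAt R` is closed from above** (`R ≥ 0`). -/
theorem mem_rungSetAt_of_forall_gt {R δ : ℝ} (hR : 0 ≤ R) (hδ : 0 < δ)
    (h : ∀ δ' : ℝ, δ < δ' → δ' ∈ RungSetAt R) : δ ∈ RungSetAt R :=
  ⟨hδ, rungAt_of_forall_gt_sep hδ hR fun δ' hδ' => (h δ' hδ').2⟩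

/-- The sharp hard-core threshold of the radius-`R` rung: `δ*(R) := inf {δ > 0 | RungAt δ R}`. [folklore] -/
def sepThreshold (R : ℝ) : ℝ := sInf (RungSetAt R)

/-- `0 ≤ δ*(R)`. -/
theorem sepThreshold_nonneg (R : ℝ) : 0 ≤ sepThreshold R :=
  le_csInf (rungSetAt_nonempty R) fun _ h => h.1.le

/-- `δ*(R) ≤ δ` for `δ ∈ RungSetAt R`. -/
theorem sepThreshold_le_of_mem {R δ : ℝ} (h : δ ∈ RungSetAt R) : sepThreshold R ≤ δ :=
  csInf_le (rungSetAt_bddBelow R) h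

/-- `δ*(R) ≤ δ_½`. -/
theorem sepThreshold_le_halfSumThreshold (R : ℝ) : sepThreshold R ≤ halfSumThreshold :=
  sepThreshold_le_of_mem (halfSumThreshold_mem_rungSetAt R)

/-- `δ_c ≤ δ*(R)`. -/
theorem critSep_le_sepThreshold (R : ℝ) : critSep ≤ sepThreshold R :=
  csInf_le_csInf rungSet_bddBelow (rungSetAt_nonempty R) (rungSetAt_subset_rungSet R)

/-- `δ*` is antitone in the radius. -/
theorem sepThreshold_antitone : Antitone sepThreshold :=
  fun R R' h => csInf_le_csInf (rungSetAt_bddBelow R') (rungSetAt_nonempty R) (rungSetAt_mono h)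

/-- Every hard core strictly above `δ*(R)` carries the radius-`R` rung. -/
theorem mem_rungSetAt_of_sepThreshold_lt {R δ : ℝ} (h : sepThreshold R < δ) : δ ∈ RungSetAt R := by
  obtain ⟨s, hs, hsδ⟩ := (csInf_lt_iff (rungSetAt_bddBelow R) (rungSetAt_nonempty R)).mp h
  exact mem_rungSetAt_of_le hs hsδ.le

/-- **Attainment**: a positive `δ*(R)` (`R ≥ 0`) carries the radius-`R` rung itself. -/
theorem sepThreshold_mem {R : ℝ} (hR : 0 ≤ R) (hpos : 0 < sepThreshold R) : sepThreshold R ∈ RungSetAt R :=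
  mem_rungSetAt_of_forall_gt hR hpos fun _ h => mem_rungSetAt_of_sepThreshold_lt h

/-- **The radius-`R` rung holds exactly on a closed ray**: for `R ≥ 0` and `δ > 0`,
`RungAt δ R ↔ δ*(R) ≤ δ`. -/
theorem rungAt_iff_sepThreshold_le {R δ : ℝ} (hR : 0 ≤ R) (hδ : 0 < δ) :
    RungAt δ R ↔ sepThreshold R ≤ δ := by
  refine ⟨fun h => sepThreshold_le_of_mem ⟨hδ, h⟩, fun h => ?_⟩
  rcases h.lt_or_eq with hlt | heq
  · exact (mem_rungSetAt_of_sepThreshold_lt hlt).2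
  · have hmem := sepThreshold_mem hR (heq ▸ hδ)
    rw [heq] at hmem
    exact hmem.2

/-- No positive hard core strictly below `δ*(R)` carries the radius-`R` rung. -/
theorem not_rungAt_of_lt_sepThreshold {R δ : ℝ} (hδ : 0 < δ) (h : δ < sepThreshold R) : ¬ RungAt δ R :=
  fun hr => absurd (sepThreshold_le_of_mem ⟨hδ, hr⟩) (not_le.mpr h)

/-- **Closed form for small radii**: `δ*(R) = δ_½` for every `R < 47/50` (below `47/50` no rule of radius
`< 47/50` is feasible, `not_rungAt_47_50`; above it such a rule sees no neighbour and the half-sum threshold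
decides). -/
theorem sepThreshold_eq_halfSumThreshold_of_lt {R : ℝ} (hR : R < 47 / 50) :
    sepThreshold R = halfSumThreshold := by
  refine le_antisymm (sepThreshold_le_halfSumThreshold R) (le_csInf (rungSetAt_nonempty R) fun δ hδ => ?_)
  by_cases hle : δ ≤ 47 / 50
  · exact absurd hδ.2 (not_rungAt_47_50 δ R hle hR)
  · exact (rungAt_iff_threshold_le_of_lt hδ.1 (hR.trans (not_le.mp hle))).1 hδ.2

/-- `δ_c` is the infimum of the thresholds `δ*(R)`. -/
theorem isGLB_critSep : IsGLB (Set.range sepThreshold) critSep := by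
  refine ⟨?_, fun b hb => ?_⟩
  · rintro _ ⟨R, rfl⟩
    exact critSep_le_sepThreshold R
  · refine le_of_forall_gt_imp_ge_of_dense fun δ hδ => ?_
    obtain ⟨hδpos, R, -, hR⟩ := mem_rungSet_of_critSep_lt hδ
    exact (hb ⟨R, rfl⟩).trans (sepThreshold_le_of_mem ⟨hδpos, hR⟩)

/-- `δ_c = ⨅_R δ*(R)`. -/
theorem critSep_eq_iInf : critSep = ⨅ R : ℝ, sepThreshold R :=
  (isGLB_critSep.ciInf_eq).symm

/-- `δ*(R) → δ_c` as `R → ∞`. -/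
theorem tendsto_sepThreshold : Tendsto sepThreshold atTop (𝓝 critSep) := by
  rw [critSep_eq_iInf]
  exact tendsto_atTop_ciInf sepThreshold_antitone ⟨0, by rintro _ ⟨R, rfl⟩; exact sepThreshold_nonneg R⟩

/-- **Crux r2 is `δ*(R) → 0`**: `FiniteRangeSplitting ↔ Tendsto δ* atTop (𝓝 0)`. -/
theorem finiteRangeSplitting_iff_tendsto :
    Summit.AtomisticToContinuum.Crystallization.Theses.FreeSplittingCertificates.FiniteRangeSplitting ↔
      Tendsto sepThreshold atTop (𝓝 0) := by
  rw [finiteRangeSplitting_iff_critSep_eq_zero]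
  refine ⟨fun h => ?_, fun h => tendsto_nhds_unique tendsto_sepThreshold h⟩
  rw [← h]
  exact tendsto_sepThreshold

/-- Summary: at every radius `R ≥ 0` the rung has an attained sharp threshold `δ*(R) ∈ [δ_c, δ_½]`, equal to
`δ_½` for `R < 47/50`, antitone and converging to `δ_c`; crux r2 says the limit is `0`. -/
theorem sepThreshold_summary :
    (∀ R δ : ℝ, 0 ≤ R → 0 < δ → (RungAt δ R ↔ sepThreshold R ≤ δ)) ∧
    (∀ R : ℝ, critSep ≤ sepThreshold R ∧ sepThreshold R ≤ halfSumThreshold) ∧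
    (∀ R : ℝ, R < 47 / 50 → sepThreshold R = halfSumThreshold) ∧
    Antitone sepThreshold ∧ Tendsto sepThreshold atTop (𝓝 critSep) ∧
    (Summit.AtomisticToContinuum.Crystallization.Theses.FreeSplittingCertificates.FiniteRangeSplitting ↔
      Tendsto sepThreshold atTop (𝓝 0)) :=
  ⟨fun _ _ hR hδ => rungAt_iff_sepThreshold_le hR hδ,
    fun R => ⟨critSep_le_sepThreshold R, sepThreshold_le_halfSumThreshold R⟩,
    fun _ hR => sepThreshold_eq_halfSumThreshold_of_lt hR, sepThreshold_antitone, tendsto_sepThreshold,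
    finiteRangeSplitting_iff_tendsto⟩

end Summit.AtomisticToContinuum.Crystallization.Theorems.StrictSplittingRuleBirth

end
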